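import Summits.KontsevichZagierPeriods.KontsevichZagierPeriods.Theorems.LinRedNormalFormHoffmanSpanInKZEdsDSDefs
import Summits.KontsevichZagierPeriods.KontsevichZagierPeriods.Theorems.LinRedNormalFormHoffmanSpanInKZEdsDSMasters
import Summits.KontsevichZagierPeriods.KontsevichZagierPeriods.Theorems.LinRedNormalFormHoffmanSpanInKZEdsDSMastersC
import Summits.KontsevichZagierPeriods.KontsevichZagierPeriods.Theorems.FurushoPentagonKernelModuloPeriodConjectureLeafWeightLeSeventeen
import HarnessLib

/-!
# Crux `LinRedNormalForm.HoffmanSpanInKZ` (stmt-KontsevichZagierPeriods-15044), line `eds-ds`: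
# the double-shuffle leaf in weights `14 … 17` (registered stub `stub_dsLeaf_14_17`)

Line `eds-ds` (lead c3). The LANDED block certificates of route FurushoPentagon (crux stmt-15058) for the
weights `14` (`stub_edsBlock_14_*`, plain blocks), `15` (`stub_edsBlockG_15_0_5` + plain, mixed), `16`
(`stub_edsBlockGC_16_*`, grouped-compacted) and `17` (`stub_edsBlockC(X)_17_*` + `stub_chainOK_17b`, cell
blocks) — Ihara–Kaneko–Zagier's linearised EDS system full rank mod 2 on the non-Hoffman admissible
words, kernel-checked — are fed to the GENERIC masters (`…EdsDSMasters*`: solution class abstracted to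
"group-like, `c_y = 0`, valid rows of weight `k` vanish") and then to the bridge `leafDS_of_leafRows`
(E5′ `evalZ_rowZ_of_gds`: the rows DO vanish at every group-like double-shuffle solution with `c_y = 0`).
Result: `stub_dsLeaf_14_17` — the double-shuffle leaf `LeafDS s` for every admissible `s` with
`14 ≤ |s| ≤ 17`, with NO pentagon and NO reducedness, and with ZERO new certificates (the two cruxes
15044 and 15058 now share one engine). Through the skeleton's glue (`spanAt_of_leafDS`, realisation
`DoubleShuffleInKZ` + descent `IntegerDivision`) this lifts crux 15044 from weight `≤ 13` to `≤ 17`.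

References: K. Ihara, M. Kaneko, D. Zagier, Compos. Math. 142 (2006) §2, Thm 2, Conjecture 1
[IharaKanekoZagier2006]; M. Kaneko, M. Noro, K. Tsurumaki, IMA Vol. Math. Appl. 148 (2008); G. Racinet,
Publ. Math. IHÉS 95 (2002) Def. 3.1; H. Furusho, Ann. of Math. 174 (2011) §2 [Furusho2011].
-/

namespace Summit.KontsevichZagierPeriods.LinRedNormalForm.HoffmanSpanInKZ

open Literature.NumberTheory.Transcendental
open Summit.KontsevichZagierPeriods.FurushoPentagon.KernelModuloPeriodConjecture

/-! ## The generic expansions in weights 14 … 17 from the landed certificates -/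

/-- **Weight 14, generic**: the Hoffman expansion of every admissible index of weight `14` at every
group-like series with `c_y = 0` on which the valid rows of weight `14` vanish — from the five depth-block
certificates `stub_edsBlock_14_*` of route FurushoPentagon by the generic block master.
[cite: IharaKanekoZagier2006, Conjecture 1] -/
theorem leafRows_weight_14 (s : List ℕ) (hs : MZV.IsAdmissible s) (hw : MZV.weight s = 14) :
    ∃ b : List ℕ →₀ ℚ, (∀ t ∈ b.support, MZV.IsHoffman t ∧ MZV.weight t = MZV.weight s) ∧ ∀ (R : Type) [CommRing R] [Algebra ℚ R] (φ : NCSeries Bool R), NCSeries.IsGroupLike φ → φ [true] = 0 → (∀ nm : List ℕ × List ℕ, LinEDS.validName 14 nm = true → LinEDS.evalZ φ (LinEDS.rowZ nm) = 0) → φ (MZV.binaryWord s) = b.sum (fun t q => q • φ (MZV.binaryWord t)) := by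
  refine stub_leafRows_of_checkBlocks 14 [(0, 6), (6, 7), (7, 8), (8, 9), (9, 13)] (by norm_num)
    (List.cons_ne_nil _ _) (by decide) rfl (by decide) (fun p hp => ?_)
    (show LinEDS.depthCovered 14 13 = true from stub_depthCovered_14) s hs hw
  simp only [List.mem_cons, List.not_mem_nil, or_false] at hp
  rcases hp with rfl | rfl | rfl | rfl | rfl
  · exact stub_edsBlock_14_0_6
  · exact stub_edsBlock_14_6_7
  · exact stub_edsBlock_14_7_8
  · exact stub_edsBlock_14_8_9
  · exact stub_edsBlock_14_9_13

/-- **Weight 15, generic**: the Hoffman expansion of every admissible index of weight `15` at every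
group-like series with `c_y = 0` on which the valid rows of weight `15` vanish — from the landed block
certificates of route FurushoPentagon by the generic master `leafRows_of_checkBlocks_mixed`.
[cite: IharaKanekoZagier2006, Conjecture 1] -/
theorem leafRows_weight_15 (s : List ℕ) (hs : MZV.IsAdmissible s) (hw : MZV.weight s = 15) :
    ∃ b : List ℕ →₀ ℚ, (∀ t ∈ b.support, MZV.IsHoffman t ∧ MZV.weight t = MZV.weight s) ∧ ∀ (R : Type) [CommRing R] [Algebra ℚ R] (φ : NCSeries Bool R), NCSeries.IsGroupLike φ → φ [true] = 0 → (∀ nm : List ℕ × List ℕ, LinEDS.validName 15 nm = true → LinEDS.evalZ φ (LinEDS.rowZ nm) = 0) → φ (MZV.binaryWord s) = b.sum (fun t q => q • φ (MZV.binaryWord t)) := by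
  refine leafRows_of_checkBlocks_mixed 15 [(0, 5), (5, 6), (6, 7), (7, 8), (8, 9), (9, 10), (10, 14)]
    (by norm_num) (List.cons_ne_nil _ _) (by decide) rfl (by decide) (fun p hp => ?_)
    (show LinEDS.depthCovered 15 14 = true from depthCovered_15) s hs hw
  simp only [List.mem_cons, List.not_mem_nil, or_false] at hp
  rcases hp with rfl | rfl | rfl | rfl | rfl | rfl | rfl
  · exact Or.inr stub_edsBlockG_15_0_5
  · exact Or.inl stub_edsBlock_15_5_6
  · exact Or.inl stub_edsBlock_15_6_7
  · exact Or.inl stub_edsBlock_15_7_8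
  · exact Or.inl stub_edsBlock_15_8_9
  · exact Or.inl stub_edsBlock_15_9_10
  · exact Or.inl stub_edsBlock_15_10_14

/-- **Weight 16, generic**: the Hoffman expansion of every admissible index of weight `16` at every
group-like series with `c_y = 0` on which the valid rows of weight `16` vanish — from the landed block
certificates of route FurushoPentagon by the generic master `stub_leafRows_of_checkBlocksGC`.
[cite: IharaKanekoZagier2006, Conjecture 1] -/
theorem leafRows_weight_16 (s : List ℕ) (hs : MZV.IsAdmissible s) (hw : MZV.weight s = 16) :
    ∃ b : List ℕ →₀ ℚ, (∀ t ∈ b.support, MZV.IsHoffman t ∧ MZV.weight t = MZV.weight s) ∧ ∀ (R : Type) [CommRing R] [Algebra ℚ R] (φ : NCSeries Bool R), NCSeries.IsGroupLike φ → φ [true] = 0 → (∀ nm : List ℕ × List ℕ, LinEDS.validName 16 nm = true → LinEDS.evalZ φ (LinEDS.rowZ nm) = 0) → φ (MZV.binaryWord s) = b.sum (fun t q => q • φ (MZV.binaryWord t)) := by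
  refine stub_leafRows_of_checkBlocksGC 16 [(0, 5), (5, 6), (6, 7), (7, 8), (8, 9), (9, 10), (10, 15)]
    (by norm_num) (List.cons_ne_nil _ _) (by decide) rfl (by decide) (fun p hp => ?_)
    (show LinEDS.depthCovered 16 15 = true from depthCovered_16) s hs hw
  simp only [List.mem_cons, List.not_mem_nil, or_false] at hp
  rcases hp with rfl | rfl | rfl | rfl | rfl | rfl | rfl
  · exact stub_edsBlockGC_16_0_5
  · exact stub_edsBlockGC_16_5_6
  · exact stub_edsBlockGC_16_6_7
  · exact stub_edsBlockGC_16_7_8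
  · exact stub_edsBlockGC_16_8_9
  · exact stub_edsBlockGC_16_9_10
  · exact stub_edsBlockGC_16_10_15

/-- **Weight 17, generic**: the Hoffman expansion of every admissible index of weight `17` at every
group-like series with `c_y = 0` on which the valid rows of weight `17` vanish — from the landed block
certificates of route FurushoPentagon by the generic master `stub_leafRows_of_checkBlocksCX`.
[cite: IharaKanekoZagier2006, Conjecture 1] -/
theorem leafRows_weight_17 (s : List ℕ) (hs : MZV.IsAdmissible s) (hw : MZV.weight s = 17) :
    ∃ b : List ℕ →₀ ℚ, (∀ t ∈ b.support, MZV.IsHoffman t ∧ MZV.weight t = MZV.weight s) ∧ ∀ (R : Type) [CommRing R] [Algebra ℚ R] (φ : NCSeries Bool R), NCSeries.IsGroupLike φ → φ [true] = 0 → (∀ nm : List ℕ × List ℕ, LinEDS.validName 17 nm = true → LinEDS.evalZ φ (LinEDS.rowZ nm) = 0) → φ (MZV.binaryWord s) = b.sum (fun t q => q • φ (MZV.binaryWord t)) := by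
  refine stub_leafRows_of_checkBlocksCX 17 _ (by norm_num) stub_chainOK_17b (fun p hp => ?_) s hs hw
  simp only [List.mem_cons, List.not_mem_nil, or_false] at hp
  rcases hp with rfl | rfl | rfl | rfl | rfl | rfl | rfl | rfl | rfl | rfl | rfl | rfl | rfl | rfl | rfl | rfl | rfl | rfl | rfl | rfl | rfl | rfl
  · exact Or.inr stub_edsBlockCX_17_A
  · exact Or.inr stub_edsBlockCX_17_B
  · exact Or.inl stub_edsBlockC_17_C
  · exact Or.inl stub_edsBlockC_17_D
  · exact Or.inl stub_edsBlockC_17_E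
  · exact Or.inl stub_edsBlockC_17_F
  · exact Or.inl stub_edsBlockC_17_G
  · exact Or.inl stub_edsBlockC_17_H
  · exact Or.inl stub_edsBlockC_17_I
  · exact Or.inl stub_edsBlockC_17_J
  · exact Or.inl stub_edsBlockC_17_K
  · exact Or.inl stub_edsBlockC_17_L
  · exact Or.inl stub_edsBlockC_17_M
  · exact Or.inl stub_edsBlockC_17_N
  · exact Or.inl stub_edsBlockC_17_O
  · exact Or.inl stub_edsBlockC_17_P
  · exact Or.inl stub_edsBlockC_17_Q
  · exact Or.inl stub_edsBlockC_17_R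
  · exact Or.inl stub_edsBlockC_17_S
  · exact Or.inl stub_edsBlockC_17_T
  · exact Or.inl stub_edsBlockC_17_V
  · exact Or.inl stub_edsBlockC_17_U

/-! ## The double-shuffle leaf -/

/-- The double-shuffle leaf in weight `14`. [cite: IharaKanekoZagier2006, Conjecture 1] -/
theorem leafDS_weight_14 (s : List ℕ) (hs : MZV.IsAdmissible s) (hw : MZV.weight s = 14) : LeafDS s :=
  leafDS_of_leafRows hw (leafRows_weight_14 s hs hw)

/-- The double-shuffle leaf in weight `15`. [cite: IharaKanekoZagier2006, Conjecture 1] -/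
theorem leafDS_weight_15 (s : List ℕ) (hs : MZV.IsAdmissible s) (hw : MZV.weight s = 15) : LeafDS s :=
  leafDS_of_leafRows hw (leafRows_weight_15 s hs hw)

/-- The double-shuffle leaf in weight `16`. [cite: IharaKanekoZagier2006, Conjecture 1] -/
theorem leafDS_weight_16 (s : List ℕ) (hs : MZV.IsAdmissible s) (hw : MZV.weight s = 16) : LeafDS s :=
  leafDS_of_leafRows hw (leafRows_weight_16 s hs hw)

/-- The double-shuffle leaf in weight `17`. [cite: IharaKanekoZagier2006, Conjecture 1] -/
theorem leafDS_weight_17 (s : List ℕ) (hs : MZV.IsAdmissible s) (hw : MZV.weight s = 17) : LeafDS s :=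
  leafDS_of_leafRows hw (leafRows_weight_17 s hs hw)

/-- **Registered stub `stub_dsLeaf_14_17`** of line `eds-ds` (crux stmt-KontsevichZagierPeriods-15044):
the double-shuffle leaf for every admissible index `s` with `14 ≤ |s| ≤ 17` — one Hoffman expansion of
`c_{bw s}` valid at every group-like solution of the generalised double shuffle with `c_{X₁} = 0`, over
every commutative `ℚ`-algebra. [cite: IharaKanekoZagier2006, Conjecture 1] -/
theorem stub_dsLeaf_14_17 :
    ∀ s : List ℕ, MZV.IsAdmissible s → 14 ≤ MZV.weight s → MZV.weight s ≤ 17 → LeafDS s := by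
  intro s hs h14 h17
  by_cases h₁ : MZV.weight s = 14
  · exact leafDS_weight_14 s hs h₁
  by_cases h₂ : MZV.weight s = 15
  · exact leafDS_weight_15 s hs h₂
  by_cases h₃ : MZV.weight s = 16
  · exact leafDS_weight_16 s hs h₃
  exact leafDS_weight_17 s hs (by omega)

end Summit.KontsevichZagierPeriods.LinRedNormalForm.HoffmanSpanInKZ
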